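import Mathlib
import HarnessLib
import Summits.Ventures.LatticeQCDFlow.Scoring.MartingaleArrayCharFun

/-!
# The martingale central limit theorem for TRIANGULAR ARRAYS (McLeish), II: row sums
# `Σ_{t<k_n} ζ_{n,t} ⇒ N(0, v)` for array increments orthogonal to their past with
# `|ζ_{n,t}| ≤ c_n → 0` and quadratic variation `Σ_{t<k_n} ζ_{n,t}² → v` IN PROBABILITY — no sure bound

HONEST FRAMING: exact (Metropolis-corrected) sampling algorithms for lattice gauge theory;
figures of merit are autocorrelation/cost numbers at stated couplings and volumes; no
continuum-physics claim.

Venture `LatticeQCDFlow` (cell pub-lqcd), topic `Scoring`; FANOUT row 4 (`s0-u1-b`, GEN-30).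
NEW WORK of the cell (a Lean proof of a textbook theorem), not a published result of ours; no
definition is introduced; nothing is cited as a fact — McLeish's martingale central limit theorem
for arrays with asymptotically negligible bounded increments (McLeish, Ann. Probab. 2 (1974), Thm 2.3;
Hall–Heyde 1980, Thm 3.2), NAMED ONLY.  `Scoring/MartingaleArrayCharFun.lean` proved
`Σ_{t<k_n} ζ_{n,t} ⇒ N(0, v)` under an additional SURE bound `Σ_t ζ_{n,t}² ≤ K`.  The quadratic
variation of the array behind the batch-means estimator is not surely bounded (only bounded in
`L¹` and convergent in probability).  This file removes the sure bound by the classical stopping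
argument: STOP the row when the running quadratic variation exceeds `v + 1`,
`ζ'_{n,t} = ζ_{n,t} · 1{Σ_{s<t} ζ_{n,s}² ≤ v + 1}`.  The stopped array is again orthogonal to its past
(the stopping indicator and the stopped history are bounded measurable functions of the un-stopped
history — **`stopped_orthogonal`**), has `|ζ'| ≤ c_n`, quadratic variation `≤ v + 1 + c_n²` SURELY
(**`sum_sq_stopped_le`**) and equal to the un-stopped one whenever the latter stays below `v + 1` —
an event of probability `→ 1` — so `Σ_t ζ'² → v` in probability, Part I gives `Σ_t ζ'_{n,t} ⇒ N(0, v)`,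
and `Σ_t ζ_{n,t} − Σ_t ζ'_{n,t} = 0` outside that vanishing event
(`MeasureTheory.tendstoInDistribution_of_tendstoInMeasure_sub`).

## Content

* `sum_sq_range_mono`, **`sum_sq_stopped_le`**, `stopped_eq_of_sum_sq_le` — deterministic
  bookkeeping of the stopped row;
* `measurable_stopped`, **`stopped_orthogonal`**;
* **`tendstoInDistribution_rowSum_of_orthogonal`** — THE THEOREM: `ζ_{n,t}` measurable,
  `|ζ_{n,t}| ≤ c_n → 0`, `∫ F(ζ_{n,0}, …, ζ_{n,t−1}) ζ_{n,t} dP = 0` for bounded measurable `F`,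
  `Σ_{t<k_n} ζ_{n,t}² → v` in probability, `0 ≤ v` ⇒ for every `Y ∼ N(0, v)`,
  `TendstoInDistribution (fun n ω => Σ_{t<k_n} ζ_{n,t} ω) atTop Y (fun _ => P) P'`.

NOT CLAIMED: Lindeberg-type (unbounded) increments; conditional-variance normalisation; rates;
functional versions; random row lengths.
-/

noncomputable section

namespace Summit.Ventures.LatticeQCDFlow.Scoring

open MeasureTheory ProbabilityTheory Filter Finset Complex
open Summit.Ventures.LatticeQCDFlow.Exactness.GeneralNCMC
open scoped Topology Real

variable {Ω : Type*} [MeasurableSpace Ω]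

/-! ### Deterministic bookkeeping for the stopped row -/

section Stopping

/-- Running sums of squares are monotone. -/
theorem sum_sq_range_mono (z : ℕ → ℝ) {t m : ℕ} (h : t ≤ m) :
    ∑ s ∈ range t, z s ^ 2 ≤ ∑ s ∈ range m, z s ^ 2 :=
  Finset.sum_le_sum_of_subset_of_nonneg (Finset.range_mono h) fun _ _ _ => sq_nonneg _

/-- **The stopped row has quadratic variation at most `K + c²`**, and if the whole row's running sum
of squares stays below `K` nothing is stopped. -/
theorem sum_sq_stopped_le (z : ℕ → ℝ) {K c : ℝ} (hK : 0 ≤ K) (hc : ∀ t, |z t| ≤ c) :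
    ∀ m : ℕ, (∑ t ∈ range m, (if ∑ s ∈ range t, z s ^ 2 ≤ K then z t else 0) ^ 2 ≤ K + c ^ 2) ∧
      ((∑ s ∈ range m, z s ^ 2 ≤ K) →
        ∑ t ∈ range m, (if ∑ s ∈ range t, z s ^ 2 ≤ K then z t else 0) ^ 2
          = ∑ s ∈ range m, z s ^ 2)
  | 0 => by simp [add_nonneg hK (sq_nonneg c)]
  | m + 1 => by
    obtain ⟨ih1, ih2⟩ := sum_sq_stopped_le z hK hc m
    have hzc : z m ^ 2 ≤ c ^ 2 := by
      rw [← sq_abs]; exact pow_le_pow_left₀ (abs_nonneg _) (hc m) 2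
    refine ⟨?_, fun hle => ?_⟩
    · rw [Finset.sum_range_succ]
      by_cases hm : ∑ s ∈ range m, z s ^ 2 ≤ K
      · rw [if_pos hm, ih2 hm]; linarith
      · rw [if_neg hm]; simpa using ih1
    · have hm : ∑ s ∈ range m, z s ^ 2 ≤ K :=
        (sum_sq_range_mono z (Nat.le_succ m)).trans hle
      rw [Finset.sum_range_succ, Finset.sum_range_succ, if_pos hm, ih2 hm]

/-- If the whole row's running sum of squares stays below `K`, the stopped increments ARE the
increments. -/
theorem stopped_eq_of_sum_sq_le (z : ℕ → ℝ) {K : ℝ} {m : ℕ} (hle : ∑ s ∈ range m, z s ^ 2 ≤ K)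
    {t : ℕ} (ht : t < m) :
    (if ∑ s ∈ range t, z s ^ 2 ≤ K then z t else 0) = z t :=
  if_pos ((sum_sq_range_mono z ht.le).trans hle)

end Stopping

/-! ### The stopped array is again orthogonal to its past -/

section StoppedOrthogonal

variable {P : Measure Ω} {ζ : ℕ → ℕ → Ω → ℝ}

/-- Measurability of a stopped increment. -/
theorem measurable_stopped (hζm : ∀ n t, Measurable (ζ n t)) (K : ℝ) (n t : ℕ) :
    Measurable fun ω => if ∑ s ∈ range t, ζ n s ω ^ 2 ≤ K then ζ n t ω else 0 :=
  Measurable.ite (measurableSet_le (Finset.measurable_sum _ fun s _ => (hζm n s).pow_const 2)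
    measurable_const) (hζm n t) measurable_const

/-- **Orthogonality passes to the stopped array**: the stopping indicator and the stopped past are
bounded measurable functions of the un-stopped past. -/
theorem stopped_orthogonal (K : ℝ)
    (horth : ∀ (n t : ℕ) (F : (Fin t → ℝ) → ℝ) (K' : ℝ), Measurable F → (∀ w, |F w| ≤ K') →
      ∫ ω, F (fun i => ζ n i ω) * ζ n t ω ∂P = 0)
    (n t : ℕ) (F : (Fin t → ℝ) → ℝ) (K' : ℝ) (hF : Measurable F) (hFb : ∀ w, |F w| ≤ K') :
    ∫ ω, F (fun i : Fin t => if ∑ s ∈ range (i : ℕ), ζ n s ω ^ 2 ≤ K then ζ n i ω else 0)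
        * (if ∑ s ∈ range t, ζ n s ω ^ 2 ≤ K then ζ n t ω else 0) ∂P = 0 := by
  classical
  -- extend a finite history by zero
  let ext : (Fin t → ℝ) → ℕ → ℝ := fun w s => if h : s < t then w ⟨s, h⟩ else 0
  have hext_m : ∀ s, Measurable fun w : Fin t → ℝ => ext w s := by
    intro s
    by_cases h : s < t
    · simp only [ext, dif_pos h]; exact measurable_pi_apply _
    · simp only [ext, dif_neg h]; exact measurable_const
  have hext_eq : ∀ (ω : Ω) (i : ℕ), i ≤ t →
      ∑ s ∈ range i, ext (fun j : Fin t => ζ n j ω) s ^ 2 = ∑ s ∈ range i, ζ n s ω ^ 2 := by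
    intro ω i hi
    refine Finset.sum_congr rfl fun s hs => ?_
    have hs' : s < t := lt_of_lt_of_le (Finset.mem_range.1 hs) hi
    simp only [ext, dif_pos hs']
  -- the test function of the un-stopped past
  let G : (Fin t → ℝ) → ℝ := fun w =>
    F (fun i : Fin t => if ∑ s ∈ range (i : ℕ), ext w s ^ 2 ≤ K then w i else 0)
      * (if ∑ s ∈ range t, ext w s ^ 2 ≤ K then 1 else 0)
  have hsum_m : ∀ i : ℕ, Measurable fun w : Fin t → ℝ => ∑ s ∈ range i, ext w s ^ 2 := fun i =>
    Finset.measurable_sum _ fun s _ => (hext_m s).pow_const 2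
  have hGm : Measurable G := by
    refine (hF.comp (measurable_pi_lambda _ fun i => ?_)).mul ?_
    · exact Measurable.ite (measurableSet_le (hsum_m i) measurable_const) (measurable_pi_apply i)
        measurable_const
    · exact Measurable.ite (measurableSet_le (hsum_m t) measurable_const) measurable_const
        measurable_const
  have hGb : ∀ w, |G w| ≤ K' := by
    intro w
    have hK'0 : 0 ≤ K' := (abs_nonneg _).trans (hFb w)
    simp only [G]
    split_ifs
    · rw [mul_one]; exact hFb _
    · rw [mul_zero, abs_zero]; exact hK'0
  have hpt : ∀ ω,
      F (fun i : Fin t => if ∑ s ∈ range (i : ℕ), ζ n s ω ^ 2 ≤ K then ζ n i ω else 0)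
        * (if ∑ s ∈ range t, ζ n s ω ^ 2 ≤ K then ζ n t ω else 0)
      = G (fun i : Fin t => ζ n i ω) * ζ n t ω := by
    intro ω
    have hin : (fun i : Fin t => if ∑ s ∈ range (i : ℕ), ext (fun j : Fin t => ζ n j ω) s ^ 2 ≤ K
        then ζ n i ω else 0)
        = fun i : Fin t => if ∑ s ∈ range (i : ℕ), ζ n s ω ^ 2 ≤ K then ζ n i ω else 0 := by
      funext i; rw [hext_eq ω i i.2.le]
    simp only [G, hin, hext_eq ω t le_rfl]
    split_ifs <;> ring
  simp_rw [hpt]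
  exact horth n t G K' hGm hGb

end StoppedOrthogonal

/-! ### The theorem -/

section Core

variable {P : Measure Ω} [IsProbabilityMeasure P] {ζ : ℕ → ℕ → Ω → ℝ} {k : ℕ → ℕ}

/-- **THE MARTINGALE CENTRAL LIMIT THEOREM FOR TRIANGULAR ARRAYS (McLeish).**  `ζ_{n,t}`
measurable with `|ζ_{n,t}| ≤ c_n`, `c_n → 0`; `∫ F(ζ_{n,0}, …, ζ_{n,t−1}) ζ_{n,t} dP = 0` for every `n, t`
and every bounded measurable `F`; `Σ_{t<k_n} ζ_{n,t}² → v` IN PROBABILITY (`0 ≤ v`).  Then for every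
real random variable `Y` with law `N(0, v)`:
`TendstoInDistribution (fun n ω => Σ_{t<k_n} ζ_{n,t} ω) atTop Y (fun _ => P) P'`. -/
theorem tendstoInDistribution_rowSum_of_orthogonal (hζm : ∀ n t, Measurable (ζ n t)) {c : ℕ → ℝ}
    (hc : ∀ n t ω, |ζ n t ω| ≤ c n) (hc0 : Tendsto c atTop (𝓝 0))
    (horth : ∀ (n t : ℕ) (F : (Fin t → ℝ) → ℝ) (K' : ℝ), Measurable F → (∀ w, |F w| ≤ K') →
      ∫ ω, F (fun i => ζ n i ω) * ζ n t ω ∂P = 0)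
    {v : ℝ} (hv : 0 ≤ v) (hQV : TendstoInMeasure P (fun n ω => ∑ t ∈ range (k n), ζ n t ω ^ 2)
      atTop (fun _ => v))
    {Ω' : Type*} [MeasurableSpace Ω'] {P' : Measure Ω'} [IsProbabilityMeasure P'] {Y : Ω' → ℝ}
    (hY : HasLaw Y (gaussianReal 0 v.toNNReal) P') :
    TendstoInDistribution (fun (n : ℕ) ω => ∑ t ∈ range (k n), ζ n t ω) atTop Y
      (fun _ => P) P' := by
  -- the stopped array
  set ζ' : ℕ → ℕ → Ω → ℝ := fun n t ω =>
    if ∑ s ∈ range t, ζ n s ω ^ 2 ≤ v + 1 then ζ n t ω else 0 with hζ'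
  have hζ'm : ∀ n t, Measurable (ζ' n t) := fun n t => measurable_stopped hζm (v + 1) n t
  have hc' : ∀ n t ω, |ζ' n t ω| ≤ c n := by
    intro n t ω
    simp only [hζ']
    split_ifs
    · exact hc n t ω
    · rw [abs_zero]; exact (abs_nonneg _).trans (hc n t ω)
  have horth' : ∀ (n t : ℕ) (F : (Fin t → ℝ) → ℝ) (K' : ℝ), Measurable F → (∀ w, |F w| ≤ K') →
      ∫ ω, F (fun i => ζ' n i ω) * ζ' n t ω ∂P = 0 := fun n t F K' hF hFb =>
    stopped_orthogonal (v + 1) horth n t F K' hF hFb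
  -- sure bound of the stopped quadratic variation
  have hK' : ∀ᶠ n in atTop, ∀ ω, ∑ t ∈ range (k n), ζ' n t ω ^ 2 ≤ v + 2 := by
    have h1 : ∀ᶠ n in atTop, c n ≤ 1 := hc0.eventually (ge_mem_nhds one_pos)
    filter_upwards [h1] with n hn ω
    have hcn : 0 ≤ c n := (abs_nonneg _).trans (hc n 0 ω)
    have h := (sum_sq_stopped_le (fun t => ζ n t ω) (K := v + 1) (by linarith)
      (fun t => hc n t ω) (k n)).1
    have hc2 : c n ^ 2 ≤ 1 := by nlinarith
    simp only [hζ']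
    linarith
  -- the bad event is contained in `{1 ≤ |Q_n − v|}`
  have hbad : ∀ n ω, ¬ (∑ s ∈ range (k n), ζ n s ω ^ 2 ≤ v + 1) →
      ω ∈ {ω | (1 : ℝ) ≤ dist (∑ t ∈ range (k n), ζ n t ω ^ 2) v} := by
    intro n ω h
    simp only [Set.mem_setOf_eq, Real.dist_eq]
    have h' : v + 1 < ∑ s ∈ range (k n), ζ n s ω ^ 2 := lt_of_not_ge h
    rw [abs_of_pos (by linarith)]
    linarith
  have hbadT : Tendsto (fun n => P {ω | (1 : ℝ) ≤ dist (∑ t ∈ range (k n), ζ n t ω ^ 2) v})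
      atTop (𝓝 0) := (tendstoInMeasure_iff_dist.1 hQV) 1 one_pos
  -- the stopped quadratic variation converges in probability to `v`
  have hQV' : TendstoInMeasure P (fun n ω => ∑ t ∈ range (k n), ζ' n t ω ^ 2) atTop
      (fun _ => v) := by
    refine tendstoInMeasure_iff_dist.2 fun ε hε => ?_
    have hsub : ∀ n, {ω | ε ≤ dist (∑ t ∈ range (k n), ζ' n t ω ^ 2) v}
        ⊆ {ω | ε ≤ dist (∑ t ∈ range (k n), ζ n t ω ^ 2) v}
          ∪ {ω | (1 : ℝ) ≤ dist (∑ t ∈ range (k n), ζ n t ω ^ 2) v} := by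
      intro n ω hω
      by_cases h : ∑ s ∈ range (k n), ζ n s ω ^ 2 ≤ v + 1
      · left
        have heq := (sum_sq_stopped_le (fun t => ζ n t ω) (K := v + 1) (by linarith)
          (fun t => hc n t ω) (k n)).2 h
        simp only [Set.mem_setOf_eq] at hω ⊢
        rwa [heq] at hω
      · right; exact hbad n ω h
    have hup : Tendsto (fun n => P {ω | ε ≤ dist (∑ t ∈ range (k n), ζ n t ω ^ 2) v}
        + P {ω | (1 : ℝ) ≤ dist (∑ t ∈ range (k n), ζ n t ω ^ 2) v}) atTop (𝓝 0) := by
      simpa using ((tendstoInMeasure_iff_dist.1 hQV) ε hε).add hbadT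
    exact tendsto_of_tendsto_of_tendsto_of_le_of_le tendsto_const_nhds hup
      (fun n => zero_le) (fun n => (measure_mono (hsub n)).trans (measure_union_le _ _))
  -- the stopped row sums are asymptotically Gaussian
  have hS' : TendstoInDistribution (fun (n : ℕ) ω => ∑ t ∈ range (k n), ζ' n t ω) atTop Y
      (fun _ => P) P' :=
    tendstoInDistribution_rowSum_of_bound hζ'm hc' hc0 horth' hK' hv hQV' hY
  -- and they differ from the row sums only on the bad event
  have hXm : ∀ n : ℕ, Measurable fun ω => ∑ t ∈ range (k n), ζ n t ω := fun n =>
    Finset.measurable_sum _ fun t _ => hζm n t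
  have hdiff : TendstoInMeasure P
      ((fun (n : ℕ) ω => ∑ t ∈ range (k n), ζ n t ω)
        - fun (n : ℕ) ω => ∑ t ∈ range (k n), ζ' n t ω) atTop 0 := by
    refine tendstoInMeasure_iff_dist.2 fun ε hε => ?_
    have hsub : ∀ n, {ω | ε ≤ dist (((fun (n : ℕ) ω => ∑ t ∈ range (k n), ζ n t ω)
        - fun (n : ℕ) ω => ∑ t ∈ range (k n), ζ' n t ω) n ω) ((0 : ℕ → Ω → ℝ) n ω)}
        ⊆ {ω | (1 : ℝ) ≤ dist (∑ t ∈ range (k n), ζ n t ω ^ 2) v} := by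
      intro n ω hω
      by_contra hcon
      have h : ∑ s ∈ range (k n), ζ n s ω ^ 2 ≤ v + 1 := by
        by_contra h'; exact hcon (hbad n ω h')
      have heq : ∑ t ∈ range (k n), ζ' n t ω = ∑ t ∈ range (k n), ζ n t ω :=
        Finset.sum_congr rfl fun t ht =>
          stopped_eq_of_sum_sq_le (fun s => ζ n s ω) h (Finset.mem_range.1 ht)
      simp only [Set.mem_setOf_eq, Pi.sub_apply, Pi.zero_apply, heq, sub_self, dist_self] at hω
      exact absurd hω (not_le.2 hε)
    exact tendsto_of_tendsto_of_tendsto_of_le_of_le tendsto_const_nhds hbadT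
      (fun n => zero_le) (fun n => measure_mono (hsub n))
  exact tendstoInDistribution_of_tendstoInMeasure_sub _ Y hS' hdiff fun n => (hXm n).aemeasurable

end Core

end Summit.Ventures.LatticeQCDFlow.Scoring

end
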